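import Summits.Parity.GeneralizedHardyLittlewood.Theorems.ChenParityOracleBLAPHostParityFromBrickTypeIIGood
import HarnessLib

/-!
# Route `ChenParityOracleBLAP` — crux S1 = `HostParityFromBrick` (stmt-Parity-20045): Type-II pieces — good classes, wide range

Support file for the prime half `K1 → K2 → HP1` of S1 (Type-II dispatch of Vaughan's identity).
Extension of `good_class_level_sum_le` to the whole range `ρ(x^{1/3−δ}+1) ≤ M ≤ x^{2/3}/2` of the
dyadic variable: when the `m`-class lies above `x^{1/2}` the roles of `m` and `n` are swapped
before applying the brick (the bilinear form is symmetric in `(m, α) ↔ (n, β)`), the `n`-class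
then lying in `[x^{1/3−δ}, x^{1/2}]` automatically (`good_class_window_wide`,
`good_class_level_sum_le_wide`).

References: H. Iwaniec, E. Kowalski, *Analytic Number Theory* (2004), §13.4, §17.3
[IwaniecKowalski2004].
-/

namespace Summit.Parity.GeneralizedHardyLittlewood.Theorems

open Finset Real
open ArithmeticFunction (liouville)

/-- **Window of a good class, wide range.**  With `2M ≤ x^{2/3}` instead of `2M ≤ x^{1/2}`:
both boxes `Mᵢ = ⌈ρ^i⌉−1`, `N_c = ⌈ρ^c⌉−1` are `≥ x^{1/3−δ}`, the product window holds, and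
`Mᵢ ≤ x^{1/2}` if `ρ^i ≤ x^{1/2}`, `N_c ≤ x^{1/2}` otherwise. -/
theorem good_class_window_wide {x : ℕ} (hx : 1 ≤ x) {δ ρ : ℝ} (hρ : 1 < ρ) (hδ : δ ≤ 1 / 3)
    {M y i c m₀ : ℕ} (hMlo : ρ * ((x : ℝ) ^ (1 / 3 - δ) + 1) ≤ M)
    (hMhi : 2 * (M : ℝ) ≤ (x : ℝ) ^ (2 / 3 : ℝ)) (hm₀ : m₀ ∈ Ioc M (2 * M))
    (hm₀i : ⌊Real.log (m₀ : ℝ) / Real.log ρ⌋₊ = i) (hbot : 4 * (x : ℝ) ^ (1 - δ) ≤ ρ ^ (i + c))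
    (htop : ρ ^ (i + c + 2) ≤ (y : ℝ)) (hyx : y ≤ x) :
    (x : ℝ) ^ (1 / 3 - δ) ≤ ((⌈ρ ^ i⌉₊ - 1 : ℕ) : ℝ) ∧
      (x : ℝ) ^ (1 / 3 - δ) ≤ ((⌈ρ ^ c⌉₊ - 1 : ℕ) : ℝ) ∧
      (x : ℝ) ^ (1 - δ) ≤ ((⌈ρ ^ i⌉₊ - 1 : ℕ) : ℝ) * ((⌈ρ ^ c⌉₊ - 1 : ℕ) : ℝ) ∧
      ((⌈ρ ^ i⌉₊ - 1 : ℕ) : ℝ) * ((⌈ρ ^ c⌉₊ - 1 : ℕ) : ℝ) ≤ x ∧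
      (2 : ℝ) ≤ ρ ^ i ∧ (2 : ℝ) ≤ ρ ^ c ∧
      (ρ ^ i ≤ (x : ℝ) ^ (1 / 2 : ℝ) → ((⌈ρ ^ i⌉₊ - 1 : ℕ) : ℝ) ≤ (x : ℝ) ^ (1 / 2 : ℝ)) ∧
      ((x : ℝ) ^ (1 / 2 : ℝ) < ρ ^ i → ((⌈ρ ^ c⌉₊ - 1 : ℕ) : ℝ) ≤ (x : ℝ) ^ (1 / 2 : ℝ)) := by
  have hρ0 : (0 : ℝ) < ρ := by linarith
  have hx1 : (1 : ℝ) ≤ x := by exact_mod_cast hx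
  have hx0 : (0 : ℝ) < x := by linarith
  rw [Finset.mem_Ioc] at hm₀
  have hm₀1 : 1 ≤ m₀ := by omega
  obtain ⟨hlo, hhi⟩ := rho_class_bounds hρ hm₀1 hm₀i
  have hMm : (M : ℝ) < m₀ := by exact_mod_cast hm₀.1
  have hm2M : (m₀ : ℝ) ≤ 2 * M := by exact_mod_cast hm₀.2
  have hx13 : (1 : ℝ) ≤ (x : ℝ) ^ (1 / 3 - δ) := Real.one_le_rpow hx1 (by linarith)
  have hρi : (x : ℝ) ^ (1 / 3 - δ) + 1 < ρ ^ i := by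
    have h1 : (M : ℝ) < ρ ^ (i + 1) := hMm.trans hhi
    rw [pow_succ] at h1
    nlinarith
  have hρi2 : (2 : ℝ) ≤ ρ ^ i := by linarith
  have hρi23 : ρ ^ i ≤ (x : ℝ) ^ (2 / 3 : ℝ) := hlo.trans (hm2M.trans hMhi)
  -- `ρ^c ≥ 4 x^{1/3-δ}`
  have hρc : 4 * (x : ℝ) ^ (1 / 3 - δ) ≤ ρ ^ c := by
    have h1 : ρ ^ (i + c) = ρ ^ i * ρ ^ c := pow_add _ _ _
    have h2 : 4 * (x : ℝ) ^ (1 - δ) ≤ (x : ℝ) ^ (2 / 3 : ℝ) * ρ ^ c := by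
      calc 4 * (x : ℝ) ^ (1 - δ) ≤ ρ ^ i * ρ ^ c := by rw [← h1]; exact hbot
        _ ≤ (x : ℝ) ^ (2 / 3 : ℝ) * ρ ^ c := mul_le_mul_of_nonneg_right hρi23 (by positivity)
    have h3 : (x : ℝ) ^ (1 - δ) = (x : ℝ) ^ (2 / 3 : ℝ) * (x : ℝ) ^ (1 / 3 - δ) := by
      rw [← Real.rpow_add hx0]; ring_nf
    rw [h3] at h2
    have h4 : 0 < (x : ℝ) ^ (2 / 3 : ℝ) := by positivity
    nlinarith
  have hρc2 : (2 : ℝ) ≤ ρ ^ c := by linarith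
  -- the boxes as reals
  set Mi : ℕ := ⌈ρ ^ i⌉₊ - 1 with hMi
  set Nc : ℕ := ⌈ρ ^ c⌉₊ - 1 with hNc
  have hMireal : (Mi : ℝ) = ⌈ρ ^ i⌉₊ - 1 := by
    have h1 : 1 ≤ ⌈ρ ^ i⌉₊ := Nat.one_le_ceil_iff.mpr (by linarith)
    rw [hMi, Nat.cast_sub h1, Nat.cast_one]
  have hNcreal : (Nc : ℝ) = ⌈ρ ^ c⌉₊ - 1 := by
    have h1 : 1 ≤ ⌈ρ ^ c⌉₊ := Nat.one_le_ceil_iff.mpr (by linarith)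
    rw [hNc, Nat.cast_sub h1, Nat.cast_one]
  have hMilt : (Mi : ℝ) < ρ ^ i := by
    rw [hMireal]; linarith [Nat.ceil_lt_add_one (show (0 : ℝ) ≤ ρ ^ i by positivity)]
  have hMige : ρ ^ i - 1 ≤ (Mi : ℝ) := by rw [hMireal]; linarith [Nat.le_ceil (ρ ^ i)]
  have hNclt : (Nc : ℝ) < ρ ^ c := by
    rw [hNcreal]; linarith [Nat.ceil_lt_add_one (show (0 : ℝ) ≤ ρ ^ c by positivity)]
  have hNcge : ρ ^ c - 1 ≤ (Nc : ℝ) := by rw [hNcreal]; linarith [Nat.le_ceil (ρ ^ c)]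
  have hyx' : (y : ℝ) ≤ x := by exact_mod_cast hyx
  refine ⟨by linarith, by linarith, ?_, ?_, hρi2, hρc2, fun h => by linarith, fun h => ?_⟩
  · have h1 : ρ ^ i / 2 ≤ (Mi : ℝ) := by linarith
    have h2 : ρ ^ c / 2 ≤ (Nc : ℝ) := by linarith
    have h3 : ρ ^ i / 2 * (ρ ^ c / 2) ≤ (Mi : ℝ) * Nc := mul_le_mul h1 h2 (by positivity) (by linarith)
    have h4 : ρ ^ (i + c) = ρ ^ i * ρ ^ c := pow_add _ _ _
    nlinarith
  · have h1 : (Mi : ℝ) * Nc ≤ ρ ^ i * ρ ^ c := mul_le_mul hMilt.le hNclt.le (by linarith) (by positivity)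
    have h2 : ρ ^ i * ρ ^ c ≤ ρ ^ (i + c + 2) := by
      rw [← pow_add]; exact pow_le_pow_right₀ hρ.le (by omega)
    linarith
  · -- `ρ^i > x^{1/2}`: `ρ^c ≤ x/ρ^i < x^{1/2}`
    have h1 : ρ ^ i * ρ ^ c ≤ x := by
      have h2 : ρ ^ i * ρ ^ c ≤ ρ ^ (i + c + 2) := by
        rw [← pow_add]; exact pow_le_pow_right₀ hρ.le (by omega)
      linarith
    have hsq : (x : ℝ) ^ (1 / 2 : ℝ) * (x : ℝ) ^ (1 / 2 : ℝ) = x := by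
      rw [← Real.rpow_add hx0]; norm_num
    have h3 : ρ ^ c ≤ (x : ℝ) ^ (1 / 2 : ℝ) := by
      by_contra hlt
      push Not at hlt
      have : (x : ℝ) ^ (1 / 2 : ℝ) * (x : ℝ) ^ (1 / 2 : ℝ) < ρ ^ i * ρ ^ c :=
        mul_lt_mul'' h hlt (by positivity) (by positivity)
      linarith
    linarith

/-- **A good class is bounded by the brick, wide range.**  As `good_class_level_sum_le` but with
`2M ≤ x^{2/3}`; the roles of `m` and `n` are swapped when `ρ^i > x^{1/2}`. -/
theorem good_class_level_sum_le_wide {x : ℕ} (hx : 1 ≤ x) {δ ε A : ℝ} (hε : 0 ≤ ε) (hδ : δ ≤ 1 / 3)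
    (hw : 2 < Real.exp (Real.log x / Real.log (Real.log x)))
    (hK1 : ∀ M N : ℕ, (x : ℝ) ^ (1 / 3 - δ) ≤ M → (M : ℝ) ≤ (x : ℝ) ^ (1 / 2 : ℝ) →
      (x : ℝ) ^ (1 - δ) ≤ (M : ℝ) * N → (M : ℝ) * N ≤ x → ∀ α β : ℕ → ℝ, (∀ n, |α n| ≤ 1) →
      (∀ n, |β n| ≤ 1) →
      (∀ n, α n ≠ 0 → ∀ p ∈ n.primeFactors, Real.exp (Real.log x / Real.log (Real.log x)) ≤ p) →
      (∀ n, β n ≠ 0 → ∀ p ∈ n.primeFactors, Real.exp (Real.log x / Real.log (Real.log x)) ≤ p) →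
      ∀ h : ℤ, (h = 2 ∨ h = -2) →
      |∑ m ∈ Finset.Ioc M (2 * M), ∑ n ∈ Finset.Ioc N (2 * N),
        α m * β n * (ArithmeticFunction.liouville (Int.toNat ((m : ℤ) * n + h)) : ℝ)| ≤
        (x : ℝ) / Real.log x ^ A)
    (hK2 : ∀ M N : ℕ, (x : ℝ) ^ (1 / 3 - δ) ≤ M → (M : ℝ) ≤ (x : ℝ) ^ (1 / 2 : ℝ) →
      (x : ℝ) ^ (1 - δ) ≤ (M : ℝ) * N → (M : ℝ) * N ≤ x → ∀ α β : ℕ → ℝ, (∀ n, |α n| ≤ 1) →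
      (∀ n, |β n| ≤ 1) →
      (∀ n, α n ≠ 0 → ∀ p ∈ n.primeFactors, Real.exp (Real.log x / Real.log (Real.log x)) ≤ p) →
      (∀ n, β n ≠ 0 → ∀ p ∈ n.primeFactors, Real.exp (Real.log x / Real.log (Real.log x)) ≤ p) →
      ∀ h : ℤ, (h = 2 ∨ h = -2) →
      (∑ d ∈ (Finset.Icc 1 ⌊(x : ℝ) ^ (1 / 2 - ε)⌋₊).filter (fun d : ℕ => Odd d),
        |(∑ m ∈ Finset.Ioc M (2 * M), ∑ n ∈ (Finset.Ioc N (2 * N)).filter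
            (fun n : ℕ => (d : ℤ) ∣ (m : ℤ) * n + h),
            α m * β n * (ArithmeticFunction.liouville (Int.toNat ((m : ℤ) * n + h)) : ℝ)) -
          (Nat.totient d : ℝ)⁻¹ * ∑ m ∈ Finset.Ioc M (2 * M), ∑ n ∈ Finset.Ioc N (2 * N),
            α m * β n * (ArithmeticFunction.liouville (Int.toNat ((m : ℤ) * n + h)) : ℝ)|) ≤
        (x : ℝ) / Real.log x ^ A)
    {ρ : ℝ} (hρ : 1 < ρ) (hρ2 : ρ ≤ 6 / 5)
    {M y V₀ i c m₀ : ℕ} (hMlo : ρ * ((x : ℝ) ^ (1 / 3 - δ) + 1) ≤ M)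
    (hMhi : 2 * (M : ℝ) ≤ (x : ℝ) ^ (2 / 3 : ℝ)) (hm₀ : m₀ ∈ Ioc M (2 * M))
    (hm₀i : ⌊Real.log (m₀ : ℝ) / Real.log ρ⌋₊ = i) (hbot : 4 * (x : ℝ) ^ (1 - δ) ≤ ρ ^ (i + c))
    (htop : ρ ^ (i + c + 2) ≤ (y : ℝ)) (hyx : y ≤ x) (hV₀ : (V₀ : ℝ) < ρ ^ c)
    {α β : ℕ → ℝ} (hα : ∀ n, |α n| ≤ 1) (hβ : ∀ n, |β n| ≤ 1)
    (hαs : ∀ n, α n ≠ 0 → ∀ p ∈ n.primeFactors, Real.exp (Real.log x / Real.log (Real.log x)) ≤ p)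
    (hβs : ∀ n, β n ≠ 0 → ∀ p ∈ n.primeFactors, Real.exp (Real.log x / Real.log (Real.log x)) ≤ p) :
    ∑ d ∈ Icc 1 ⌊(x : ℝ) ^ (1 / 2 - ε)⌋₊,
      |∑ m ∈ (Ioc M (2 * M)).filter (fun m : ℕ => ⌊Real.log (m : ℝ) / Real.log ρ⌋₊ = i),
        ∑ n ∈ (Ioc V₀ (y / m)).filter (fun n : ℕ => ⌊Real.log (n : ℝ) / Real.log ρ⌋₊ = c),
          α m * β n * (if d ∣ m * n + 2 then (liouville (m * n + 2) : ℝ) else 0)| ≤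
      (1 + (1 + Real.log x) ^ 2) * ((x : ℝ) / Real.log x ^ A) := by
  classical
  obtain ⟨hW1, hW1', hW3, hW4, hi2, hc2, hcaseA, hcaseB⟩ :=
    good_class_window_wide hx hρ hδ hMlo hMhi hm₀ hm₀i hbot htop hyx
  set Mi : ℕ := ⌈ρ ^ i⌉₊ - 1 with hMi
  set Nc : ℕ := ⌈ρ ^ c⌉₊ - 1 with hNc
  set α' : ℕ → ℝ := fun m =>
    (if m ∈ Ioc M (2 * M) ∧ ⌊Real.log (m : ℝ) / Real.log ρ⌋₊ = i then (1 : ℝ) else 0) * α m with hα'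
  set β' : ℕ → ℝ := fun n =>
    (if ⌊Real.log (n : ℝ) / Real.log ρ⌋₊ = c then (1 : ℝ) else 0) * β n with hβ'
  have hα'1 : ∀ n, |α' n| ≤ 1 := by
    intro n; simp only [hα']; split_ifs <;> simp [hα n]
  have hβ'1 : ∀ n, |β' n| ≤ 1 := by
    intro n; simp only [hβ']; split_ifs <;> simp [hβ n]
  have hα's : ∀ n, α' n ≠ 0 → ∀ p ∈ n.primeFactors,
      Real.exp (Real.log x / Real.log (Real.log x)) ≤ p := by
    intro n hn; apply hαs n; intro h; apply hn; simp only [hα', h, mul_zero]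
  have hβ's : ∀ n, β' n ≠ 0 → ∀ p ∈ n.primeFactors,
      Real.exp (Real.log x / Real.log (Real.log x)) ≤ p := by
    intro n hn; apply hβs n; intro h; apply hn; simp only [hβ', h, mul_zero]
  -- the class sum as the box sum (for every `d`), in both orders
  have hid : ∀ d : ℕ,
      ∑ m ∈ (Ioc M (2 * M)).filter (fun m : ℕ => ⌊Real.log (m : ℝ) / Real.log ρ⌋₊ = i),
        ∑ n ∈ (Ioc V₀ (y / m)).filter (fun n : ℕ => ⌊Real.log (n : ℝ) / Real.log ρ⌋₊ = c),
          α m * β n * (if d ∣ m * n + 2 then (liouville (m * n + 2) : ℝ) else 0) =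
      ∑ m ∈ Ioc Mi (2 * Mi), ∑ n ∈ (Ioc Nc (2 * Nc)).filter
          (fun n : ℕ => (d : ℤ) ∣ (m : ℤ) * n + 2),
        α' m * β' n * (liouville (Int.toNat ((m : ℤ) * n + 2)) : ℝ) := by
    intro d
    rw [good_class_eq_box hρ hρ2 hi2 hc2 htop hV₀]
    refine Finset.sum_congr rfl fun m _ => ?_
    rw [Finset.sum_filter]
    refine Finset.sum_congr rfl fun n _ => ?_
    obtain ⟨hdvd, htoNat⟩ := shift_two_cast d m n
    simp only [hα', hβ', htoNat]
    by_cases hd : d ∣ m * n + 2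
    · rw [if_pos hd, if_pos (hdvd.mpr hd)]; ring
    · rw [if_neg hd, if_neg (fun h => hd (hdvd.mp h))]; ring
  by_cases hcase : ρ ^ i ≤ (x : ℝ) ^ (1 / 2 : ℝ)
  · have hbrick := brick_box_sum_le hx hε hw hK1 hK2 hW1 (hcaseA hcase) hW3 hW4 hα'1 hβ'1 hα's hβ's
      (h := 2) (Or.inl rfl)
    simp only [hid]
    exact hbrick
  · push Not at hcase
    have hW3' : (x : ℝ) ^ (1 - δ) ≤ ((⌈ρ ^ c⌉₊ - 1 : ℕ) : ℝ) * ((⌈ρ ^ i⌉₊ - 1 : ℕ) : ℝ) := by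
      rw [mul_comm]; exact hW3
    have hW4' : ((⌈ρ ^ c⌉₊ - 1 : ℕ) : ℝ) * ((⌈ρ ^ i⌉₊ - 1 : ℕ) : ℝ) ≤ x := by
      rw [mul_comm]; exact hW4
    have hbrick := brick_box_sum_le hx hε hw hK1 hK2 hW1' (hcaseB hcase) hW3' hW4' hβ'1 hα'1 hβ's hα's
      (h := 2) (Or.inl rfl)
    -- swap the order of summation in the class sum
    have hswap : ∀ d : ℕ,
        ∑ m ∈ Ioc Mi (2 * Mi), ∑ n ∈ (Ioc Nc (2 * Nc)).filter
            (fun n : ℕ => (d : ℤ) ∣ (m : ℤ) * n + 2),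
          α' m * β' n * (liouville (Int.toNat ((m : ℤ) * n + 2)) : ℝ) =
        ∑ n ∈ Ioc Nc (2 * Nc), ∑ m ∈ (Ioc Mi (2 * Mi)).filter
            (fun m : ℕ => (d : ℤ) ∣ (n : ℤ) * m + 2),
          β' n * α' m * (liouville (Int.toNat ((n : ℤ) * m + 2)) : ℝ) := by
      intro d
      simp_rw [Finset.sum_filter]
      rw [Finset.sum_comm]
      refine Finset.sum_congr rfl fun n _ => Finset.sum_congr rfl fun m _ => ?_
      rw [mul_comm (n : ℤ) (m : ℤ), mul_comm (β' n) (α' m)]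
    simp only [hid, hswap]
    exact hbrick

end Summit.Parity.GeneralizedHardyLittlewood.Theorems
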